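import Summits.BirchSwinnertonDyer.BirchSwinnertonDyer.Theorems.GenusKolyvaginAtTwoEquivariantKolyvaginExactAtTwoKolyvaginPrimeDictionary
import Summits.BirchSwinnertonDyer.BirchSwinnertonDyer.Theorems.ByReductionTypeAtTwoRankOneAtTwoBigImageOddLocalOneDoorBottomPosStepB
import Literature.NumberTheory.EllipticCurves.H1UnramifiedFinite
import Literature.NumberTheory.EllipticCurves.KummerMap
import Literature.NumberTheory.EllipticCurves.SelmerTorsionRestriction
import Literature.NumberTheory.GaloisRepresentations.ArtinFormalismInductionProofs
import HarnessLib

/-!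
# Route `GenusKolyvaginAtTwo`, residual `OffCutResidualAtTwoR` (stmt-BirchSwinnertonDyer-31767), LINE 27 «socle_selection» STUB S2a (HL) —
# DESCENT OF PHANTOM CLASSES ALONG A QUADRATIC FIELD: `res_K x` phantom over `K` ⟹ `x` phantom over `ℚ` (given `E(K)[2] = 0`)

Seat `bsd-line-gk2-p4` g30 (cell `bsd-f1-sign2`), WIDTH-5 attach on route `GenusKolyvaginAtTwo` rev 59.  `--supports stmt-BirchSwinnertonDyer-31767 --as
helper`.  THEOREMS ONLY (no definition, no named fact, no `sorry`); standard axioms.  **BSD is NOT proved by this file; `OffCutResidualAtTwoR` is NOT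
proved; LINE 27's stub S2a (HL) is NOT closed by this file alone.**

WHY.  (HL) is stated over the Heegner field `K` («no non-zero multiple of the level-raised Heegner class `c • ι c_M(1) ∈ H¹(K, E[2^{M+1}])` is
phantom», phantom = `[θ, ρ] = 0` for all `ρ ∈ Γ_{K(E[2^{M+1}])}`), while the visibility argument that kills phantom classes (`…RealVisible*`: a
real-trivial phantom class of `H¹(ℚ, E[2^k])` is `0`) lives over `ℚ`, where there is a real place.  The Heegner socle is `res_K` of a class over `ℚ`
(LEAD gk2-p1 g25, `…HeegnerSocleSOC`), so (HL) needs: **`res_K x` phantom over `K` ⟹ `x` phantom over `ℚ`.**  This file proves it for ANY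
quadratic number field `K` and any level `n`, under `E(K)[2] = 0`:

* §1 `h1Eval_one` / `h1Eval_conj_of_mem_torsionFixing` — the chosen cocycle `Φ = [x, ·]` of a class is a crossed homomorphism on ALL of `Γ`
  (tree `RankOneAtTwoOneDoor.h1Eval_mul_smul`), and `Φ(γ ρ γ⁻¹) = γ • Φ(ρ)` for `ρ ∈ Γ_{F(E[n])}` (any field `F`).
* §2 `mem_torsionFixing_baseChange_iff` — `τ ∈ Γ_{L(E_L[n])} ⟺ res τ ∈ Γ_{F(E[n])}` (any algebraic `L/F`; the coefficient transport
  `torsionBaseChangeMap` is an equivariant bijection).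
* §3 ★ `forall_h1Eval_eq_zero_of_resTorsion` — `[K : ℚ] = 2`, `x ∈ H¹(ℚ, E[n])`, `res_K x` phantom over `K`, and no non-zero `Γ_ℚ`-fixed `T ∈ E[n]`
  with `2T = 0` ⟹ `x` phantom over `ℚ`.  Proof: `Φ` vanishes on `N := Γ_{ℚ(E[n])} ∩ res Γ_K` (`h1Eval_resTorsion_eq`), a subgroup of index `≤ 2` of
  `Γ_{ℚ(E[n])}` (`[Γ_ℚ : res Γ_K] = 2`, `index_range_absGaloisRestrict_eq_finrank`); off `N` the crossed homomorphism takes a single value `P` with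
  `2P = Φ(ρ²) = 0`, and `Φ(γ ρ γ⁻¹) = γ • P` forces `γ • P = P` for every `γ ∈ Γ_ℚ`; so `P = 0`.  `geomTorsion_eq_zero_of_forall_smul_eq` — the
  fixed-point clause from `E(K)[2] = 0` (Galois descent `E(K̄)^{Γ_K} = E(K)`, tree `mem_range_toGeomPoints_iff`; `E(K)[2] = 0` is automatic for
  `ρ̄_{E,2}` onto and `K` imaginary quadratic, tree `torsionBy_two_baseChange_eq_bot_of_hasSurjectiveModNGaloisRep_two_of_isImaginaryQuadratic`).
BSD is NOT proved by any of this.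

References: [GrossLMS1991] §9 (the pairing `[s, ρ]`, `𝒢 ≅ GL₂`); [McCallumLMS1991] §3 Prop. 3.1; [SerreGaloisCohomology1997] I.§2.2, I.§2.4, II.§1.1;
[SilvermanAEC2009] VIII.§1.
-/

set_option autoImplicit false
set_option linter.dupNamespace false -- `Summit.<P>.<Sub>` repeats `BirchSwinnertonDyer` (D-0017)

noncomputable section

open scoped Classical

namespace Summit.BirchSwinnertonDyer.BirchSwinnertonDyer.Theorems.GenusExact.PlusDescent.SocleSelection.RealVisible

open WeierstrassCurve Field NumberField Literature.NumberTheory.EllipticCurves Literature.NumberTheory.GaloisRepresentations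
open Summit.BirchSwinnertonDyer.BirchSwinnertonDyer.Theorems.GenusExact.SelmerDescent (h1Eval_resTorsion_eq)
open Summit.BirchSwinnertonDyer.BirchSwinnertonDyer.Theorems.RankOneAtTwoOneDoor (h1Eval_mul_smul)


/-! ## §1 The chosen cocycle is a crossed homomorphism on all of `Γ` -/

section Cocycle

variable {F : Type} [Field F] (X : WeierstrassCurve F) (n : ℤ)

/-- `[x, 1] = 0`. [cite: SerreGaloisCohomology1997, I.§2.2] -/
theorem h1Eval_one (x : galH1Torsion X n) : h1Eval X n x 1 = 0 := by
  have h := h1Eval_mul_smul X n x 1 1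
  rw [mul_one, one_smul] at h
  exact left_eq_add.mp h

/-- **`[x, γ ρ γ⁻¹] = γ • [x, ρ]` for `ρ ∈ Γ_{F(E[n])}`** (crossed-homomorphism identity; `γ ρ γ⁻¹` fixes `E[n]`, and
`[x, γ] + γ • [x, γ⁻¹] = [x, 1] = 0`): the restriction of a class to `Γ_{F(E[n])}` is a `Γ_F`-equivariant homomorphism.
[cite: SerreGaloisCohomology1997, I.§2.2] [cite: GrossLMS1991, §9 (pairing after Prop. 9.1)] -/
theorem h1Eval_conj_of_mem_torsionFixing (x : galH1Torsion X n) (γ : absoluteGaloisGroup F)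
    {ρ : absoluteGaloisGroup F} (hρ : ρ ∈ torsionFixing X n) :
    h1Eval X n x (γ * ρ * γ⁻¹) = γ • h1Eval X n x ρ := by
  have hinv : h1Eval X n x γ + γ • h1Eval X n x γ⁻¹ = 0 := by
    rw [← h1Eval_mul_smul, mul_inv_cancel, h1Eval_one]
  have hconj : γ * ρ * γ⁻¹ ∈ torsionFixing X n := (torsionFixing_normal X n).conj_mem ρ hρ γ
  have h1 : (γ * ρ) • h1Eval X n x γ⁻¹ = γ • h1Eval X n x γ⁻¹ := by
    conv_lhs => rw [show γ * ρ = (γ * ρ * γ⁻¹) * γ by group, mul_smul,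
      smul_eq_of_mem_torsionFixing X n hconj]
  rw [h1Eval_mul_smul, h1Eval_mul_smul, h1, add_right_comm, hinv, zero_add]

end Cocycle

/-! ## §2 `Γ_{L(E_L[n])}` is the preimage of `Γ_{F(E[n])}` -/

section BaseChange

variable {F : Type} [Field F] (X : WeierstrassCurve F) (L : Type) [Field L] [Algebra F L] [Algebra.IsAlgebraic F L]
  (n : ℤ)

/-- **`τ ∈ Γ_{L(E_L[n])} ⟺ res τ ∈ Γ_{F(E[n])}`** for an algebraic extension `L/F`: the coefficient transport
`torsionBaseChangeMap : E[n](F̄) → E_L[n](L̄)` is a `Γ_L`-equivariant bijection (`torsionBaseChangeMap_smul`, `torsionBaseChangeMap_bijective`).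
[cite: SerreGaloisCohomology1997, II.§1.1] -/
theorem mem_torsionFixing_baseChange_iff (τ : absoluteGaloisGroup L) :
    τ ∈ torsionFixing (X.baseChange L) n ↔ resGal (K := F) L τ ∈ torsionFixing X n := by
  rw [mem_torsionFixing_iff, mem_torsionFixing_iff]
  constructor
  · intro h P
    apply torsionBaseChangeMap_injective X L n
    rw [torsionBaseChangeMap_smul]
    exact h _
  · intro h Q
    obtain ⟨P, rfl⟩ := (torsionBaseChangeMap_bijective L X n).2 Q
    rw [← torsionBaseChangeMap_smul, h P]

end BaseChange

/-! ## §3 Descent of phantom classes along a quadratic extension -/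

section Quadratic

variable (W : WeierstrassCurve ℚ) (K : Type) [Field K] [NumberField K]

/-- ★ **Descent of phantom classes along a quadratic field.**  `K/ℚ` with `[K : ℚ] = 2`, `x ∈ H¹(ℚ, E[n])`; if `res_K x` is phantom over `K`
(`[res_K x, τ] = 0` for all `τ ∈ Γ_{K(E_K[n])}`) and `E[n]` has no non-zero `Γ_ℚ`-fixed point killed by `2`, then `x` is phantom over `ℚ`
(`[x, ρ] = 0` for all `ρ ∈ Γ_{ℚ(E[n])}`).  Proof: the crossed homomorphism `Φ = [x, ·]` vanishes on `N = Γ_{ℚ(E[n])} ∩ res Γ_K`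
(`h1Eval_resTorsion_eq`, injectivity of the coefficient transport), `[Γ_ℚ : res Γ_K] = 2` (`index_range_absGaloisRestrict_eq_finrank`), so on
`Γ_{ℚ(E[n])} ∖ N` it takes one value `P` with `2P = Φ(ρ²) = 0`; `Φ(γργ⁻¹) = γ • P` (§1) and `γργ⁻¹ ∉ N` give `γ • P = P` for all `γ ∈ Γ_ℚ`,
whence `P = 0`.  BSD is NOT proved by this. [cite: GrossLMS1991, §9] [cite: McCallumLMS1991, §3 Prop. 3.1] [cite: SerreGaloisCohomology1997, I.§2.4] -/
theorem forall_h1Eval_eq_zero_of_resTorsion (hK : Module.finrank ℚ K = 2) (n : ℤ)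
    (hE2 : ∀ T : geomTorsion W n, (2 : ℤ) • T = 0 → (∀ γ : absoluteGaloisGroup ℚ, γ • T = T) → T = 0)
    (y : galH1Torsion W n)
    (hph : ∀ τ ∈ torsionFixing (W.baseChange K) n, h1Eval (W.baseChange K) n (resTorsion W K n y) τ = 0) :
    ∀ ρ ∈ torsionFixing W n, h1Eval W n y ρ = 0 := by
  haveI : Algebra.IsAlgebraic ℚ K := Algebra.IsAlgebraic.of_finite ℚ K
  set H : Subgroup (absoluteGaloisGroup ℚ) := (absGaloisRestrict ℚ K).range with hH
  have hHi : H.index = 2 := (index_range_absGaloisRestrict_eq_finrank ℚ K).trans hK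
  haveI hHn : H.Normal := Subgroup.normal_of_index_eq_two hHi
  haveI : H.FiniteIndex := ⟨by rw [hHi]; decide⟩
  -- Step 1: `Φ` vanishes on `Γ_{ℚ(E[n])} ∩ res(Γ_K)`
  have step1 : ∀ ρ ∈ torsionFixing W n, ρ ∈ H → h1Eval W n y ρ = 0 := by
    rintro ρ hρ ⟨g, hgρ⟩
    have hgρ' : absGaloisRestrict ℚ K g = ρ := hgρ
    subst hgρ'
    have hg : g ∈ torsionFixing (W.baseChange K) n := by
      rw [mem_torsionFixing_baseChange_iff, resGal_eq_absGaloisRestrict]; exact hρ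
    have h := hph g hg
    rw [h1Eval_resTorsion_eq W K n y hg, resGal_eq_absGaloisRestrict] at h
    exact torsionBaseChangeMap_injective W K n (by rw [h, map_zero])
  intro ρ hρ
  by_cases hρH : ρ ∈ H
  · exact step1 ρ hρ hρH
  set P := h1Eval W n y ρ with hP
  have hρ2 : ρ * ρ ∈ H := by
    have h := Subgroup.pow_index_mem H ρ
    rw [hHi, pow_two] at h
    exact h
  have h2P : (2 : ℤ) • P = 0 := by
    have h := step1 (ρ * ρ) (Subgroup.mul_mem _ hρ hρ) hρ2
    rw [h1Eval_mul_smul, smul_eq_of_mem_torsionFixing W n hρ, ← two_zsmul] at h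
    exact h
  have hfix : ∀ γ : absoluteGaloisGroup ℚ, γ • P = P := by
    intro γ
    have hc : γ * ρ * γ⁻¹ ∈ torsionFixing W n := (torsionFixing_normal W n).conj_mem ρ hρ γ
    have hcH : γ * ρ * γ⁻¹ ∉ H := fun h ↦ hρH (by
      have h' := hHn.conj_mem _ h γ⁻¹
      simpa [mul_assoc] using h')
    have hq : γ * ρ * γ⁻¹ * ρ⁻¹ ∈ H := by
      rw [Subgroup.mul_mem_iff_of_index_two hHi]
      exact iff_of_false hcH (fun h ↦ hρH ((Subgroup.inv_mem_iff H).mp h))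
    have hqT : γ * ρ * γ⁻¹ * ρ⁻¹ ∈ torsionFixing W n := Subgroup.mul_mem _ hc (Subgroup.inv_mem _ hρ)
    have h2 : h1Eval W n y (γ * ρ * γ⁻¹) = P := by
      have h' : γ * ρ * γ⁻¹ = (γ * ρ * γ⁻¹ * ρ⁻¹) * ρ := by group
      rw [h', h1Eval_mul_smul, step1 _ hqT hq, smul_eq_of_mem_torsionFixing W n hqT, zero_add]
    calc γ • P = h1Eval W n y (γ * ρ * γ⁻¹) := (h1Eval_conj_of_mem_torsionFixing W n y γ hρ).symm
      _ = P := h2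
  exact hE2 P h2P hfix

/-- **`E(K)[2] = 0 ⟹ E[n]` has no non-zero `Γ_ℚ`-fixed point killed by `2`** (the fixed-point clause of
`forall_h1Eval_eq_zero_of_resTorsion`): a `Γ_ℚ`-fixed `T` transports to a `Γ_K`-fixed point of `E_K[n](K̄)`, which is `K`-rational by Galois
descent (`mem_range_toGeomPoints_iff`) and killed by `2`, hence `0`. [cite: SilvermanAEC2009, VIII.§1 (proof of Prop. 1.2)] -/
theorem geomTorsion_eq_zero_of_forall_smul_eq {n : ℤ}
    (hbot : AddSubgroup.torsionBy (W.baseChange K).toAffine.Point (2 : ℤ) = ⊥)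
    (T : geomTorsion W n) (h2 : (2 : ℤ) • T = 0) (hfix : ∀ γ : absoluteGaloisGroup ℚ, γ • T = T) : T = 0 := by
  set S := torsionBaseChangeMap W K n T with hS
  have hSfix : ∀ g : absoluteGaloisGroup K, g • S = S := fun g ↦ by
    rw [hS, ← torsionBaseChangeMap_smul, hfix]
  have hfix' : (S : geomPoints (W.baseChange K)) ∈
      MulAction.fixedPoints (absoluteGaloisGroup K) (geomPoints (W.baseChange K)) := fun g ↦ by
    rw [← AddSubgroup.torsionBy.coe_smul, hSfix g]
  obtain ⟨P, hP⟩ := (mem_range_toGeomPoints_iff (W.baseChange K) _).mpr hfix'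
  have hS2 : (2 : ℤ) • S = 0 := by rw [hS, ← map_zsmul, h2, map_zero]
  have hP2 : (2 : ℤ) • P = 0 := toGeomPoints_injective (W.baseChange K) (by
    rw [map_zsmul, hP, ← AddSubgroupClass.coe_zsmul, hS2, map_zero]; rfl)
  have hP0 : P = 0 := by
    have hmem : P ∈ AddSubgroup.torsionBy (W.baseChange K).toAffine.Point (2 : ℤ) := by
      rw [AddSubgroup.torsionBy, Submodule.mem_toAddSubgroup, Submodule.mem_torsionBy_iff]; exact hP2
    rw [hbot] at hmem
    exact AddSubgroup.mem_bot.mp hmem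
  have hS0 : S = 0 := Subtype.ext (by rw [← hP, hP0, map_zero]; rfl)
  exact torsionBaseChangeMap_injective W K n (by rw [← hS, hS0, map_zero])

end Quadratic

end Summit.BirchSwinnertonDyer.BirchSwinnertonDyer.Theorems.GenusExact.PlusDescent.SocleSelection.RealVisible

end
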